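import Literature.Probability.LatticeModels.BattleFederbushWeights
import Literature.Combinatorics.Enumerative.CayleyForests
import HarnessLib

/-!
# The anchored cluster trees of the Battle–Brydges–Federbush expansion and their number
(Cayley bound; Mastropietro 2008, Lemma 2.4)

Topic `Literature/Probability/LatticeModels`; continuation of `BattleFederbushExpansion.lean` /
`BattleFederbushWeights.lean`.  The scripts of the peeling formula are regrouped by their
**line set** (the anchored cluster tree they traverse); this file provides the regrouping
vocabulary and the counting bound used in the estimates of the tree expansion
(Benfatto–Giuliani–Mastropietro 2006, after (2.68); Mastropietro 2008, Lemma 2.4, (2.120)–(2.125):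
"the number of trees `T` anchored on `{Q₁,…,Q_m}` is bounded by `m! Cⁿ`", whose cluster-level part
is Cayley's bound on the number of labelled trees):

* `Script.image_y_eq_of_lines_eq` — the lines of a valid script determine its point set;
* `lineSets v W` — the line sets of the valid scripts rooted at `v` with point set `W` (the
  anchored cluster trees on `W`), `mem_lineSets`;
* `Script.parentMap` — the parent map of a script (each new point ↦ its parent), a rooted forest
  on `W` with the single root `v` in the sense of
  `Literature.Combinatorics.Enumerative.IsForestOn` (`isForestOn_parentMap`), which determines the
  lines (`lines_toFinset_eq_image_parentMap`);
* `card_lineSets_le` — **`#(lineSets v W) ≤ #forests W {v}`**, hence **`≤ |W|^{|W|-2}`**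
  (`card_lineSets_le_pow`, Cayley's formula via `card_forests_mul_card`).

Everything is proved; no named fact.

## Sources

V. Mastropietro, *Non-Perturbative Renormalization* (2008), Lemma 2.4, (2.120)–(2.125), PDF
pp. 49–50 of the held copy (`Mastropietro2008`); A. Cayley 1889 / Aigner–Ziegler, *Proofs from THE
BOOK*, Ch. 26 (`AignerZiegler1998`, through `CayleyForests.lean`).
-/

noncomputable section

open Finset Function
open Literature.Combinatorics.Enumerative

namespace Literature.Probability.LatticeModels

namespace BattleFederbush

namespace Script

variable {ι : Type*} [DecidableEq ι] {root : ι}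

/-! ### The lines determine the points -/

/-- Two valid scripts with the same lines have the same points. [folklore] -/
theorem image_y_eq_of_lines_eq {k k' : ℕ} (s : Script root k) (s' : Script root k')
    (h : s.lines.toFinset = s'.lines.toFinset) : univ.image s.y = univ.image s'.y := by
  have key : ∀ {k k' : ℕ} (s : Script root k) (s' : Script root k'), s.lines.toFinset = s'.lines.toFinset →
      univ.image s.y ⊆ univ.image s'.y := by
    intro k k' s s' h a ha
    rcases eq_root_or_exists_line s ha with rfl | ⟨ℓ, hℓ, haℓ⟩
    · exact mem_image.2 ⟨0, mem_univ _, y_zero s'⟩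
    · have hℓ' : ℓ ∈ s'.lines := List.mem_toFinset.1 (h ▸ List.mem_toFinset.2 hℓ)
      exact mem_image_of_mem_lines s' ℓ hℓ' a haℓ
  exact Subset.antisymm (key s s' h) (key s' s h.symm)

/-! ### The parent map of a script -/

/-- The **parent map** of a script: every point added by `snoc s i z` is sent to its parent `y_i`;
the root and the points outside the script are fixed. [folklore] -/
def parentMap : {k : ℕ} → Script root k → ι → ι
  | _, nil => id
  | _, snoc s i z => Function.update (parentMap s) z (s.y i)

/-- The parent map fixes every point which is not a non-root point of the script. [folklore] -/
theorem parentMap_apply_of_notMem : {k : ℕ} → (s : Script root k) → s.Valid → ∀ {x : ι},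
    x ∉ univ.image s.y \ {root} → s.parentMap x = x
  | _, nil, _, _, _ => rfl
  | _, snoc s i z, hv, x, hx => by
    have hz : z ∈ univ.image (snoc s i z).y \ {root} := by
      refine mem_sdiff.2 ⟨mem_image.2 ⟨Fin.last _, mem_univ _, y_snoc_last s i z⟩, fun h => ?_⟩
      rw [mem_singleton] at h
      exact hv.2 0 (by rw [y_zero]; exact h.symm)
    have hxz : x ≠ z := fun h => hx (h ▸ hz)
    rw [parentMap, Function.update_of_ne hxz]
    refine parentMap_apply_of_notMem s hv.1 fun hx' => hx ?_
    obtain ⟨hx1, hx2⟩ := mem_sdiff.1 hx'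
    obtain ⟨m, -, rfl⟩ := mem_image.1 hx1
    exact mem_sdiff.2 ⟨mem_image.2 ⟨m.castSucc, mem_univ _, y_snoc_castSucc s i z m⟩, hx2⟩

/-- The parent of a point of a valid script is a point of the script. [folklore] -/
theorem parentMap_y_mem : {k : ℕ} → (s : Script root k) → s.Valid → ∀ m, s.parentMap (s.y m) ∈ univ.image s.y
  | _, nil, _, m => by simp [parentMap]
  | _, snoc s i z, hv, m => by
    induction m using Fin.lastCases with
    | last =>
      rw [y_snoc_last, parentMap, Function.update_self]
      exact mem_image.2 ⟨i.castSucc, mem_univ _, y_snoc_castSucc s i z i⟩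
    | cast m =>
      rw [y_snoc_castSucc, parentMap, Function.update_of_ne (hv.2 m)]
      obtain ⟨m', -, hm'⟩ := mem_image.1 (parentMap_y_mem s hv.1 m)
      exact mem_image.2 ⟨m'.castSucc, mem_univ _, by rw [y_snoc_castSucc, hm']⟩

/-- Iterating an updated map along an orbit which avoids the updated point. [folklore] -/
theorem iterate_update_of_forall_ne {f : ι → ι} {z w x : ι} :
    ∀ n : ℕ, (∀ m < n, f^[m] x ≠ z) → (Function.update f z w)^[n] x = f^[n] x
  | 0, _ => rfl
  | n + 1, h => by
    rw [Function.iterate_succ_apply', Function.iterate_succ_apply', iterate_update_of_forall_ne n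
      (fun m hm => h m (Nat.lt_succ_of_lt hm)), Function.update_of_ne (h n (Nat.lt_succ_self n))]

/-- Every point of a valid script reaches the root under iteration of the parent map. [folklore] -/
theorem exists_iterate_parentMap_eq_root : {k : ℕ} → (s : Script root k) → s.Valid → ∀ m,
    ∃ N : ℕ, (s.parentMap)^[N] (s.y m) = root
  | _, nil, _, m => ⟨0, by simp⟩
  | _, snoc s i z, hv, m => by
    -- the orbit of an old point stays among the old points, hence avoids `z`
    have horbit : ∀ (m : Fin (_ + 1)) (N : ℕ), (s.parentMap)^[N] (s.y m) ∈ univ.image s.y := by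
      intro m N
      induction N with
      | zero => exact mem_image.2 ⟨m, mem_univ _, rfl⟩
      | succ N ih =>
        obtain ⟨m', -, hm'⟩ := mem_image.1 ih
        rw [Function.iterate_succ_apply', ← hm']
        exact parentMap_y_mem s hv.1 m'
    have hagree : ∀ (m : Fin (_ + 1)) (N : ℕ), ((snoc s i z).parentMap)^[N] (s.y m) = (s.parentMap)^[N] (s.y m) := by
      intro m N
      rw [parentMap]
      refine iterate_update_of_forall_ne N fun M _ h => ?_
      obtain ⟨m', -, hm'⟩ := mem_image.1 (horbit m M)
      exact hv.2 m' (hm'.trans h)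
    induction m using Fin.lastCases with
    | cast m =>
      obtain ⟨N, hN⟩ := exists_iterate_parentMap_eq_root s hv.1 m
      exact ⟨N, by rw [y_snoc_castSucc, hagree, hN]⟩
    | last =>
      obtain ⟨N, hN⟩ := exists_iterate_parentMap_eq_root s hv.1 i
      refine ⟨N + 1, ?_⟩
      rw [Function.iterate_succ_apply, y_snoc_last]
      have h1 : (snoc s i z).parentMap z = s.y i := by rw [parentMap, Function.update_self]
      rw [h1, hagree, hN]

/-- **The lines of a script are the edges of its parent map**: `lines(s) = {{x, parent x} :
x a non-root point}`. [folklore] -/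
theorem lines_toFinset_eq_image_parentMap : {k : ℕ} → (s : Script root k) → s.Valid →
    s.lines.toFinset = (univ.image s.y \ {root}).image fun x => s(x, s.parentMap x)
  | _, nil, _ => by
    simp [lines]
  | _, snoc s i z, hv => by
    have hroot : root ∈ univ.image s.y := mem_image.2 ⟨0, mem_univ _, y_zero s⟩
    have hz : z ∉ univ.image s.y := fun h => by
      obtain ⟨m, -, hm⟩ := mem_image.1 h; exact hv.2 m hm
    have hzr : z ≠ root := fun h => hz (h ▸ hroot)
    have himage : univ.image (snoc s i z).y = insert z (univ.image s.y) := by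
      ext a
      simp only [mem_image, mem_univ, true_and, mem_insert]
      constructor
      · rintro ⟨m, rfl⟩
        induction m using Fin.lastCases with
        | last => exact Or.inl (y_snoc_last s i z)
        | cast m => exact Or.inr ⟨m, by rw [y_snoc_castSucc]⟩
      · rintro (h | ⟨m, rfl⟩)
        · exact ⟨Fin.last _, by rw [y_snoc_last, h]⟩
        · exact ⟨m.castSucc, y_snoc_castSucc s i z m⟩
    rw [lines, List.toFinset_append, List.toFinset_cons, List.toFinset_nil, insert_empty_eq,
      lines_toFinset_eq_image_parentMap s hv.1, himage, Finset.insert_sdiff_of_notMem _ (by simpa using hzr),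
      image_insert, parentMap, Function.update_self, Sym2.eq_swap, union_comm, ← insert_eq]
    congr 1
    refine image_congr fun x hx => ?_
    have hxz : x ≠ z := fun h => hz (h ▸ (mem_sdiff.1 hx).1)
    rw [Function.update_of_ne hxz]

/-- **The parent map of a valid script is a rooted tree on its point set** (a rooted forest with
the root as its only root, in the sense of `CayleyForests`). [folklore] -/
theorem isForestOn_parentMap {k : ℕ} (s : Script root k) (hs : s.Valid) :
    IsForestOn (univ.image s.y) {root} s.parentMap := by
  refine ⟨fun x hx => parentMap_apply_of_notMem s hs hx, fun x hx => ?_⟩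
  obtain ⟨m, -, rfl⟩ := mem_image.1 hx
  obtain ⟨N, hN⟩ := exists_iterate_parentMap_eq_root s hs m
  exact ⟨N, by rw [hN]; exact mem_singleton_self _⟩

end Script

/-! ### The anchored cluster trees and their number -/

variable {ι : Type*} [DecidableEq ι] [Fintype ι]

/-- The **anchored cluster trees** of `W` rooted at `v`: the line sets of the valid scripts rooted at
`v` with point set `W` (Mastropietro 2008, §2.8: the anchored trees `T` on `X_r`, modulo the
compatible sequences `X₂, …`). [folklore] -/
def lineSets (v : ι) (W : Finset ι) : Finset (Finset (Sym2 ι)) :=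
  (range (Fintype.card ι)).biUnion fun k =>
    (univ.filter fun s : Script v k => s.Valid ∧ univ.image s.y = W).image fun s => s.lines.toFinset

/-- Membership in `lineSets`. [folklore] -/
theorem mem_lineSets {v : ι} {W : Finset ι} {T : Finset (Sym2 ι)} :
    T ∈ lineSets v W ↔ ∃ k < Fintype.card ι, ∃ s : Script v k, s.Valid ∧ univ.image s.y = W ∧ s.lines.toFinset = T := by
  simp only [lineSets, mem_biUnion, mem_range, mem_image, mem_filter, mem_univ, true_and]
  constructor
  · rintro ⟨k, hk, s, ⟨hs, hW⟩, hT⟩; exact ⟨k, hk, s, hs, hW, hT⟩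
  · rintro ⟨k, hk, s, hs, hW, hT⟩; exact ⟨k, hk, s, ⟨hs, hW⟩, hT⟩

/-- **The anchored cluster trees inject into the rooted trees on `W`** (parent maps), so their
number is at most the number of rooted forests on `W` with the single root `v`. [folklore] -/
theorem card_lineSets_le (v : ι) (W : Finset ι) : (lineSets v W).card ≤ (forests W {v}).card := by
  classical
  -- choose a script for each line set and take its parent map
  have hex : ∀ T : lineSets v W, ∃ t : ι → ι, t ∈ forests W {v} ∧
      (T : Finset (Sym2 ι)) = (W \ {v}).image fun x => s(x, t x) := by
    rintro ⟨T, hT⟩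
    obtain ⟨k, -, s, hs, hW, rfl⟩ := mem_lineSets.1 hT
    subst hW
    refine ⟨s.parentMap, ?_, ?_⟩
    · rw [mem_forests]; exact Script.isForestOn_parentMap s hs
    · exact Script.lines_toFinset_eq_image_parentMap s hs
  choose Φ hΦ using hex
  have hinj : Function.Injective Φ := by
    intro T T' h
    apply Subtype.ext
    rw [(hΦ T).2, (hΦ T').2, h]
  calc (lineSets v W).card = Fintype.card (lineSets v W) := (Fintype.card_coe _).symm
    _ ≤ Fintype.card (forests W {v}) :=
        Fintype.card_le_of_injective (fun T => ⟨Φ T, (hΦ T).1⟩) fun T T' h => hinj (congrArg Subtype.val h)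
    _ = (forests W {v}).card := Fintype.card_coe _

/-- **Cayley's bound on the number of anchored cluster trees** (the cluster-level part of
Mastropietro 2008, Lemma 2.4): `#(lineSets v W) ≤ |W| ^ (|W| - 2)` for `v ∈ W`. [cite: Mastropietro2008, Lemma 2.4 (2.121)] -/
theorem card_lineSets_le_pow {v : ι} {W : Finset ι} (hv : v ∈ W) :
    (lineSets v W).card ≤ W.card ^ (W.card - 2) := by
  refine (card_lineSets_le v W).trans (le_of_eq ?_)
  have h := card_forests_mul_card W {v} (singleton_subset_iff.2 hv)
  rw [card_singleton, one_mul] at h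
  have hn : 1 ≤ W.card := card_pos.2 ⟨v, hv⟩
  have hpow : W.card ^ (W.card - 1) = W.card ^ (W.card - 2) * W.card := by
    rcases Nat.lt_or_ge W.card 2 with h2 | h2
    · have : W.card = 1 := by omega
      simp [this]
    · rw [← pow_succ]; congr 1; omega
  rw [hpow] at h
  exact Nat.eq_of_mul_eq_mul_right (by omega) h

end BattleFederbush

end Literature.Probability.LatticeModels
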